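import Summits.ValiantsHypothesis.ValiantsHypothesis.Theorems.KPlusLogSqLawSymmetricDesigns

/-!
# Route «KPlusLogSqLaw» — symmetric designs of size `m = 2`: the dominant terms are the identity terms and the NEGATIVE swap terms
# (kernel brick for the cell's patchwork ceiling `T_sym(2,K) ≤ 3K − 4`; toward crux `Lifting`, stmt-ValiantsHypothesis-19772)

HONEST FRAMING.  Object-search cell `pub-symmetroid`.  Structural lemmas about SYMMETRIC tropical designs of size `2` in the tree's dominance
vocabulary; nothing is asserted about `Lifting`, `TropicalB`, `KPlusLogSqLaw`, `MatrixDescartes`, a Door-A numeral or `VP ≠ VNP`.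
By `isDominant_symm_involutive` (companion file `KPlusLogSqLawSymmetricDesigns`) a uniquely dominant term of a symmetric design is an involution
with a cycle-constant class map; at `m = 2` this leaves the identity terms `(1, (l₀, l₁))` («product points», sign `ε₀₀(l₀)·ε₁₁(l₁)`) and the
swap terms `(swap, (l, l))` («diagonal c-points»), and the latter have sign `−ε₀₁(l)·ε₁₀(l) = −ε₀₁(l)² ≤ 0`: **every dominant swap term of a
symmetric `2 × 2` design is negative** (`termSign_swap_const_symm`, `termSign_neg_of_isDominant_swap`).  This is step (i)/(iv) of the lead's
PATCHWORK-CEILING theorem (HOME/lead/PATCHWORK-CEILING.md: sign changes along the strict vertices ≤ 3K − 4, the c-vertices being the negative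
ones) in kernel form, and the parity constraint behind the closed-form `3K − 4` family of HOME/val-sym-lift-p4/GAP-LIFT.md §8. [folklore]
-/

-- `Summit.ValiantsHypothesis.ValiantsHypothesis.…` repeats a component by the D-0017 layout
-- (single-conjunct summit), which the `dupNamespace` linter flags; the name is mandated.
set_option linter.dupNamespace false
set_option autoImplicit false

namespace Summit.ValiantsHypothesis.ValiantsHypothesis.Theorems.LacunarySymmetroidMatrixDescartes.TropicalCensus

open Summit.ValiantsHypothesis.ValiantsHypothesis.Theorems.MatrixDescartes.Negative
open scoped BigOperators
open Finset

variable {K : ℕ}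

/-- the sign of a swap term `(swap, λ)` of a `2 × 2` design: `−ε(1,0,λ 0)·ε(0,1,λ 1)`. [folklore] -/
theorem termSign_swap_two (ε : Fin 2 → Fin 2 → Fin K → ℤ) (lam : Fin 2 → Fin K) :
    termSign ε (Equiv.swap 0 1, lam) = -(ε 1 0 (lam 0) * ε 0 1 (lam 1)) := by
  unfold termSign
  rw [Equiv.Perm.sign_swap (by decide : (0 : Fin 2) ≠ 1)]
  simp [Fin.prod_univ_two, Equiv.swap_apply_left, Equiv.swap_apply_right]

/-- **Dominant swap terms of a symmetric `2 × 2` design are diagonal**: the class map is constant (`λ 0 = λ 1`). [folklore] -/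
theorem lam_const_of_isDominant_swap (d : Fin K → ℕ) (v ε : Fin 2 → Fin 2 → Fin K → ℤ)
    (hv : ∀ i j l, v i j l = v j i l) (hε : ∀ i j l, ε i j l = ε j i l) (θ : ℤ) (lam : Fin 2 → Fin K)
    (h : IsDominant d v ε θ (Equiv.swap 0 1, lam)) : lam 0 = lam 1 := by
  have h2 := (isDominant_symm_involutive d v ε hv hε θ (Equiv.swap 0 1) lam h).2 0
  rw [Equiv.swap_apply_left] at h2
  exact h2.symm

/-- the sign of a diagonal swap term `(swap, (l, l))` of a SYMMETRIC `2 × 2` design is `−ε(0,1,l)²`, hence `≤ 0`. [folklore] -/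
theorem termSign_swap_const_symm (ε : Fin 2 → Fin 2 → Fin K → ℤ) (hε : ∀ i j l, ε i j l = ε j i l) (l : Fin K) :
    termSign ε (Equiv.swap 0 1, fun _ => l) = -(ε 0 1 l) ^ 2 := by
  rw [termSign_swap_two, hε 1 0 l, sq]

/-- **Every dominant swap term of a symmetric `2 × 2` design is NEGATIVE** (the «c-vertices» of the patchwork ceiling). [folklore] -/
theorem termSign_neg_of_isDominant_swap (d : Fin K → ℕ) (v ε : Fin 2 → Fin 2 → Fin K → ℤ)
    (hv : ∀ i j l, v i j l = v j i l) (hε : ∀ i j l, ε i j l = ε j i l) (θ : ℤ) (lam : Fin 2 → Fin K)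
    (h : IsDominant d v ε θ (Equiv.swap 0 1, lam)) : termSign ε (Equiv.swap 0 1, lam) < 0 := by
  have hl := lam_const_of_isDominant_swap d v ε hv hε θ lam h
  have hlam : lam = fun _ => lam 0 := by
    funext i; fin_cases i
    · rfl
    · exact hl.symm
  have hne : termSign ε (Equiv.swap 0 1, lam) ≠ 0 := h.1
  rw [hlam] at hne ⊢
  rw [termSign_swap_const_symm ε hε] at hne ⊢
  have hsq : 0 ≤ (ε 0 1 (lam 0)) ^ 2 := sq_nonneg _
  have hsq' : (ε 0 1 (lam 0)) ^ 2 ≠ 0 := fun h0 => hne (by rw [h0, neg_zero])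
  omega

/-- **Dichotomy of dominant terms of a symmetric `2 × 2` design**: an identity term, or a NEGATIVE diagonal swap term. [folklore] -/
theorem isDominant_two_symm_cases (d : Fin K → ℕ) (v ε : Fin 2 → Fin 2 → Fin K → ℤ)
    (hv : ∀ i j l, v i j l = v j i l) (hε : ∀ i j l, ε i j l = ε j i l) (θ : ℤ)
    (p : Equiv.Perm (Fin 2) × (Fin 2 → Fin K)) (h : IsDominant d v ε θ p) :
    p.1 = 1 ∨ (p.1 = Equiv.swap 0 1 ∧ p.2 0 = p.2 1 ∧ termSign ε p < 0) := by
  -- a permutation of `Fin 2` is the identity or the swap (inlined; cf. `Literature.Geometry.Kaehler.Zucker.perm_fin_two`)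
  have hperm : ∀ σ : Equiv.Perm (Fin 2), σ = 1 ∨ σ = Equiv.swap 0 1 := by
    intro σ
    have hinj : σ 0 ≠ σ 1 := fun h => absurd (σ.injective h) (by decide)
    rcases Fin.eq_zero_or_eq_succ (σ 0) with h0 | ⟨j, hj⟩
    · left
      have h1 : σ 1 = 1 := by
        rcases Fin.eq_zero_or_eq_succ (σ 1) with h1 | ⟨j', hj'⟩
        · exact absurd (h0.trans h1.symm) hinj
        · rw [hj']; exact Fin.ext (by have := j'.isLt; simp [Fin.val_succ])
      refine Equiv.ext fun i => ?_
      fin_cases i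
      · simpa using h0
      · simpa using h1
    · right
      have h0' : σ 0 = 1 := by rw [hj]; exact Fin.ext (by have := j.isLt; simp [Fin.val_succ])
      have h1 : σ 1 = 0 := by
        rcases Fin.eq_zero_or_eq_succ (σ 1) with h1 | ⟨j', hj'⟩
        · exact h1
        · exfalso; apply hinj; rw [h0', hj']; exact Fin.ext (by have := j'.isLt; simp [Fin.val_succ])
      refine Equiv.ext fun i => ?_
      fin_cases i
      · simpa [Equiv.swap_apply_left] using h0'
      · simpa [Equiv.swap_apply_right] using h1
  rcases hperm p.1 with h1 | h1
  · exact Or.inl h1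
  · right
    have hp : p = (Equiv.swap 0 1, p.2) := Prod.ext h1 rfl
    rw [hp] at h
    refine ⟨h1, lam_const_of_isDominant_swap d v ε hv hε θ p.2 h, ?_⟩
    rw [hp]; exact termSign_neg_of_isDominant_swap d v ε hv hε θ p.2 h

end Summit.ValiantsHypothesis.ValiantsHypothesis.Theorems.LacunarySymmetroidMatrixDescartes.TropicalCensus
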